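import Summits.Ventures.HodgeRepro2.T5SU11ImproperDerivativeIdentity

/-!
# The bounds of `u′ = (G^I_λ g)′` for every `λ > 1`: the logarithmic derivative of `φ_λ` grows at most linearly

Row 525 bounded `u′ = (φ_λ′/φ_λ) u + B^I/(sinh 2t φ_λ)` for `λ > 2`, where `|φ_λ′| ≤ √μ φ_λ`. For every `λ > 1` the
radial equation integrated once, `sinh 2t φ_λ′ = μ ∫_0^t sinh 2s φ_λ`, with row 450's bound `∫_0^t sinh 2s φ_λ ≤ C₀ + c t e^{λt}`
and `φ_λ ≥ (c/2) e^{(λ−2)t}` gives the polynomial bound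

**`|φ_λ′(t)| ≤ C (1 + t) φ_λ(t)` for all `t ≥ 0`** (`exists_abs_deriv_sph_hyp_le_mul`),

which is all the argument of row 525 needs: for every `λ > 1` and a source of the exponentially decaying class,
`u′` is bounded near `0` (`eventually_abs_greenSolI'_le_all`) and `|u′(t)| ≤ K e^{−ε′ t}` beyond some `T` for
every `ε′ < min(ε, λ)` (`exists_abs_greenSolI'_le_exp_all`; the factor `1 + t` is absorbed into the rate). Nothing
is claimed about (N).

Blind lane: Mathlib + the HodgeRepro2 prefix only; no sorry; axioms ⊆ {propext, Classical.choice,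
Quot.sound}.
-/

namespace Summit.Ventures.HodgeRepro2.T5SU11ImproperDerivativeBoundsAll

open Filter Topology MeasureTheory
open Set (Ioi Ioc Icc Ioo)
open T5SU11Cartan T5SU11SphericalFunction T5SU11SphericalBounds T5SU11SphericalContinuous
  T5SU11SphericalSolutionSpaceAll T5SU11SphericalAsymptotic T5SU11SphericalCfun T5SU11SphericalDecay
  T5SU11SphericalDecayAsymptotic T5SU11SphericalDecayBracket T5SU11SphericalLpSharp T5SU11ReductionOfOrder
  T5SU11ResolventBoundary T5SU11ResolventDiagonalEdge T5SU11RadialGreenImproper T5SU11RadialGreenImproperOrigin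
  T5SU11RadialGreenImproperDecaySource T5SU11RadialGreenImproperStable T5SU11ImproperDerivativeIdentity

section measure

variable [MeasurableSpace Circle] [BorelSpace Circle]

/-- **`|φ_λ′(t)| ≤ C (1 + t) φ_λ(t)` for all `t ≥ 0`**, `λ > 1`. -/
theorem exists_abs_deriv_sph_hyp_le_mul {lam : ℝ} (hlam : 1 < lam) :
    ∃ C : ℝ, 0 ≤ C ∧ ∀ t, 0 ≤ t → |deriv (fun t => sph lam (hyp t)) t| ≤ C * (1 + t) * sph lam (hyp t) := by
  have hc : 0 < cfun (2 - lam) := cfun_pos (by linarith)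
  obtain ⟨C₀, hC₀, hC⟩ := exists_eventually_integral_sinh_sph_le hlam
  obtain ⟨T₁, hT₁⟩ := eventually_atTop.mp hC
  obtain ⟨T₂, hT₂⟩ := eventually_atTop.mp (eventually_le_sph_hyp hlam)
  set T := max (max T₁ T₂) 1 with hT
  have hT1 : 1 ≤ T := le_max_right _ _
  have hT0 : 0 < T := lt_of_lt_of_le one_pos hT1
  -- the compact part `[0, T]`
  have hcont : Continuous (deriv fun t => sph lam (hyp t)) :=
    continuous_iff_continuousAt.mpr fun t => (hasDerivAt_deriv_sph_hyp lam t).continuousAt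
  obtain ⟨t₀, _, hmax⟩ := isCompact_Icc.exists_isMaxOn (Set.nonempty_Icc.mpr hT0.le)
    (hcont.abs.continuousOn : ContinuousOn (fun t => |deriv (fun t => sph lam (hyp t)) t|) (Icc 0 T))
  set D := |deriv (fun t => sph lam (hyp t)) t₀| with hD
  have hD0 : 0 ≤ D := abs_nonneg _
  refine ⟨D * Real.exp (lam * T) + 8 * |lam * (lam - 2)| * (C₀ + cfun (2 - lam)) / cfun (2 - lam), by positivity,
    fun t ht => ?_⟩
  have hφ : 0 < sph lam (hyp t) := sph_hyp_pos lam t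
  have h1t : 0 ≤ 1 + t := by linarith
  rcases le_or_gt t T with htT | htT
  · -- `|φ′| ≤ D ≤ D e^{λT} e^{−λt} ≤ D e^{λT} φ`
    have h1 : |deriv (fun t => sph lam (hyp t)) t| ≤ D := (isMaxOn_iff.mp hmax) t ⟨ht, htT⟩
    have h2 : Real.exp (-(lam * t)) ≤ sph lam (hyp t) := exp_neg_mul_le_sph_hyp (by linarith) ht
    have h3 : 1 ≤ Real.exp (lam * T) * Real.exp (-(lam * t)) := by
      rw [← Real.exp_add]; apply Real.one_le_exp; nlinarith
    calc |deriv (fun t => sph lam (hyp t)) t| ≤ D := h1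
      _ = D * 1 := (mul_one D).symm
      _ ≤ D * (Real.exp (lam * T) * Real.exp (-(lam * t))) := mul_le_mul_of_nonneg_left h3 hD0
      _ ≤ D * (Real.exp (lam * T) * sph lam (hyp t)) :=
          mul_le_mul_of_nonneg_left (mul_le_mul_of_nonneg_left h2 (Real.exp_pos _).le) hD0
      _ = D * Real.exp (lam * T) * 1 * sph lam (hyp t) := by ring
      _ ≤ D * Real.exp (lam * T) * (1 + t) * sph lam (hyp t) := by gcongr; linarith
      _ ≤ (D * Real.exp (lam * T) + 8 * |lam * (lam - 2)| * (C₀ + cfun (2 - lam)) / cfun (2 - lam)) * (1 + t)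
          * sph lam (hyp t) := by
          have : 0 ≤ 8 * |lam * (lam - 2)| * (C₀ + cfun (2 - lam)) / cfun (2 - lam) := by positivity
          gcongr
          linarith
  · -- beyond `T`: `sinh 2t φ′ = μ ∫_0^t sinh φ`, `∫_0^t sinh φ ≤ C₀ + c t e^{λt}`, `sinh 2t ≥ e^{2t}/4`, `φ ≥ (c/2) e^{(λ−2)t}`
    have ht1 : 1 ≤ t := le_trans hT1 htT.le
    have hs : Real.exp (2 * t) / 4 ≤ Real.sinh (2 * t) := exp_div_four_le_sinh (by linarith)
    have hs0 : 0 < Real.sinh (2 * t) := sinh_two_mul_pos (by linarith)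
    have hI := hT₁ t (le_trans (le_trans (le_max_left _ _) (le_max_left _ _)) htT.le)
    have hI0 : 0 ≤ ∫ u in (0 : ℝ)..t, Real.sinh (2 * u) * sph lam (hyp u) :=
      intervalIntegral.integral_nonneg ht (fun u hu => sinh_mul_sph_hyp_nonneg lam hu.1)
    have hφl := hT₂ t (le_trans (le_trans (le_max_right _ _) (le_max_left _ _)) htT.le)
    have hder := sinh_mul_deriv_sph_hyp_eq lam t
    -- `|φ′| = |μ| ∫/sinh 2t`
    have habs : |deriv (fun t => sph lam (hyp t)) t|
        = |lam * (lam - 2)| * (∫ u in (0 : ℝ)..t, Real.sinh (2 * u) * sph lam (hyp u)) / Real.sinh (2 * t) := by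
      rw [eq_div_iff hs0.ne', ← abs_of_pos hs0, ← abs_mul, mul_comm, hder, abs_mul, abs_of_nonneg hI0]
    rw [habs, div_le_iff₀ hs0]
    have hE : 0 < Real.exp (2 * t) := Real.exp_pos _
    calc |lam * (lam - 2)| * ∫ u in (0 : ℝ)..t, Real.sinh (2 * u) * sph lam (hyp u)
        ≤ |lam * (lam - 2)| * (C₀ + t * (cfun (2 - lam) * Real.exp (lam * t))) :=
          mul_le_mul_of_nonneg_left hI (abs_nonneg _)
      _ ≤ |lam * (lam - 2)| * ((C₀ + cfun (2 - lam)) * (1 + t) * Real.exp (lam * t)) := by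
          apply mul_le_mul_of_nonneg_left _ (abs_nonneg _)
          have h1 : (1 : ℝ) ≤ Real.exp (lam * t) := Real.one_le_exp (by positivity)
          have hE' : 0 ≤ Real.exp (lam * t) := (Real.exp_pos _).le
          have hx : C₀ ≤ C₀ * Real.exp (lam * t) := le_mul_of_one_le_right hC₀ h1
          have hy : 0 ≤ C₀ * t * Real.exp (lam * t) := mul_nonneg (mul_nonneg hC₀ ht) hE'
          have hz : 0 ≤ cfun (2 - lam) * Real.exp (lam * t) := mul_nonneg hc.le hE'
          nlinarith [hx, hy, hz]
      _ = 8 * |lam * (lam - 2)| * (C₀ + cfun (2 - lam)) / cfun (2 - lam) * (1 + t)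
          * (cfun (2 - lam) / 2 * Real.exp ((lam - 2) * t)) * (Real.exp (2 * t) / 4) := by
          rw [show Real.exp (lam * t) = Real.exp ((lam - 2) * t) * Real.exp (2 * t) by
            rw [← Real.exp_add]; congr 1; ring]
          field_simp
          ring
      _ ≤ 8 * |lam * (lam - 2)| * (C₀ + cfun (2 - lam)) / cfun (2 - lam) * (1 + t) * sph lam (hyp t)
          * Real.sinh (2 * t) := by
          apply mul_le_mul (mul_le_mul_of_nonneg_left hφl (by positivity)) hs (by positivity) (by positivity)
      _ ≤ (D * Real.exp (lam * T) + 8 * |lam * (lam - 2)| * (C₀ + cfun (2 - lam)) / cfun (2 - lam)) * (1 + t)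
          * sph lam (hyp t) * Real.sinh (2 * t) := by
          have : 0 ≤ D * Real.exp (lam * T) := by positivity
          gcongr
          linarith

variable {lam : ℝ} (hlam : 1 < lam) {g : ℝ → ℝ} (hg : ContinuousOn g (Ioi 0))
  {M : ℝ} (hM : ∀ s ∈ Ioc (0 : ℝ) 1, |g s| ≤ M) (hM0 : 0 ≤ M)
  {ε C s₀ : ℝ} (hε : 2 - lam < ε) (hC : ∀ s, s₀ ≤ s → |g s| ≤ C * Real.exp (-ε * s))

include hlam hg hM hM0 hε hC in
/-- **`u′` is bounded near the origin** for every `λ > 1` and a source of the class. -/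
theorem eventually_abs_greenSolI'_le_all :
    ∃ B' : ℝ, ∀ᶠ t in 𝓝[>] (0 : ℝ), |greenSolI' (deriv fun t => sph lam (hyp t)) (sphDecay' lam)
      (fun t => sph lam (hyp t)) (sphDecay lam) g t| ≤ B' := by
  have hA := integrableOn_sphDecay_mul_mul_sinh hlam hg hM hM0 hε hC
  obtain ⟨B, hB⟩ := eventually_abs_greenSolI_le hlam hM hM0 hA
  obtain ⟨Φ, hΦ0, hΦ⟩ := exists_sph_hyp_le lam
  obtain ⟨Cφ, hCφ0, hCφ⟩ := exists_abs_deriv_sph_hyp_le_mul hlam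
  have hsinh2 : 0 < Real.sinh 2 := Real.sinh_pos_iff.mpr two_pos
  refine ⟨2 * Cφ * B + Φ * M * Real.sinh 2 * Real.exp lam / 2, ?_⟩
  filter_upwards [hB, Ioo_mem_nhdsGT one_pos] with t hBt ht
  have ht0 : 0 < t := ht.1
  have ht1 : t < 1 := ht.2
  rw [greenSolI'_eq hlam ht0]
  have hφ : 0 < sph lam (hyp t) := sph_hyp_pos lam t
  have hs : 0 < Real.sinh (2 * t) := sinh_two_mul_pos ht0
  have h1 : |deriv (fun t => sph lam (hyp t)) t / sph lam (hyp t)| ≤ 2 * Cφ := by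
    rw [abs_div, abs_of_pos hφ, div_le_iff₀ hφ]
    calc |deriv (fun t => sph lam (hyp t)) t| ≤ Cφ * (1 + t) * sph lam (hyp t) := hCφ t ht0.le
      _ = Cφ * sph lam (hyp t) * (1 + t) := by ring
      _ ≤ Cφ * sph lam (hyp t) * 2 :=
          mul_le_mul_of_nonneg_left (show 1 + t ≤ 2 by linarith) (mul_nonneg hCφ0 hφ.le)
      _ = 2 * Cφ * sph lam (hyp t) := by ring
  have hBI := abs_greenBI_le hM hM0 hΦ hΦ0.le ht0 ht1.le
  have hsinh : 2 * t ≤ Real.sinh (2 * t) := Real.self_le_sinh_iff.mpr (by linarith)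
  have hφe : Real.exp (-lam) ≤ sph lam (hyp t) := by
    refine le_trans ?_ (exp_neg_mul_le_sph_hyp (by linarith) ht0.le)
    apply Real.exp_le_exp.mpr
    nlinarith
  have hE : 0 < Real.exp (-lam) := Real.exp_pos _
  have h2' : |greenBI (fun t => sph lam (hyp t)) g t / (Real.sinh (2 * t) * sph lam (hyp t))|
      ≤ Φ * M * Real.sinh 2 * Real.exp lam / 2 := by
    rw [abs_div, abs_of_pos (mul_pos hs hφ), div_le_iff₀ (mul_pos hs hφ)]
    calc |greenBI (fun t => sph lam (hyp t)) g t| ≤ Φ * M * Real.sinh 2 * t := hBI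
      _ = Φ * M * Real.sinh 2 * Real.exp lam / 2 * (2 * t * Real.exp (-lam)) := by
          rw [show Real.exp lam = (Real.exp (-lam))⁻¹ by rw [← Real.exp_neg, neg_neg]]
          field_simp
      _ ≤ Φ * M * Real.sinh 2 * Real.exp lam / 2 * (Real.sinh (2 * t) * sph lam (hyp t)) := by
          apply mul_le_mul_of_nonneg_left _ (by positivity)
          exact mul_le_mul hsinh hφe hE.le hs.le
  calc |deriv (fun t => sph lam (hyp t)) t / sph lam (hyp t) * greenSolI (fun t => sph lam (hyp t)) (sphDecay lam) g t
        + greenBI (fun t => sph lam (hyp t)) g t / (Real.sinh (2 * t) * sph lam (hyp t))|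
      ≤ |deriv (fun t => sph lam (hyp t)) t / sph lam (hyp t)| * |greenSolI (fun t => sph lam (hyp t)) (sphDecay lam) g t|
        + |greenBI (fun t => sph lam (hyp t)) g t / (Real.sinh (2 * t) * sph lam (hyp t))| := by
        rw [← abs_mul]; exact abs_add_le _ _
    _ ≤ 2 * Cφ * B + Φ * M * Real.sinh 2 * Real.exp lam / 2 :=
        add_le_add (mul_le_mul h1 hBt (abs_nonneg _) (by positivity)) h2'

include hlam hg hM hM0 hε hC in
/-- **`|u′(t)| ≤ K e^{−ε′ t}` beyond some `T`** for every `ε′ < min(ε, λ)` and every `λ > 1`. -/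
theorem exists_abs_greenSolI'_le_exp_all {ε' : ℝ} (hε' : ε' < min ε lam) :
    ∃ K T : ℝ, 0 ≤ K ∧ 0 < T ∧ ∀ t, T ≤ t → |greenSolI' (deriv fun t => sph lam (hyp t)) (sphDecay' lam)
      (fun t => sph lam (hyp t)) (sphDecay lam) g t| ≤ K * Real.exp (-ε' * t) := by
  set ε'' := (ε' + min ε lam) / 2 with hε''
  have hε''1 : ε' < ε'' := by rw [hε'']; linarith
  have hε''2 : ε'' < min ε lam := by rw [hε'']; linarith
  obtain ⟨K₁, T₁, hK₁, hT₁, hKT₁⟩ := exists_abs_greenSolI_le_exp hlam hg hM hM0 hε hC hε''2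
  obtain ⟨K₂, T₂, hK₂, hT₂, hKT₂⟩ := abs_greenBI_le_atTop hlam hg hM hM0 hC
  obtain ⟨Cφ, hCφ0, hCφ⟩ := exists_abs_deriv_sph_hyp_le_mul hlam
  have hc : 0 < cfun (2 - lam) := cfun_pos (by linarith)
  obtain ⟨T₃, hT₃⟩ := eventually_atTop.mp (eventually_le_sph_hyp hlam)
  set δ := ε'' - ε' with hδ
  have hδ0 : 0 < δ := by rw [hδ]; linarith
  set T := max (max T₁ T₂) (max T₃ 1) with hT
  have hT0 : 0 < T := lt_of_lt_of_le one_pos (le_trans (le_max_right T₃ 1) (le_max_right _ _))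
  refine ⟨(Cφ * K₁ + 8 * K₂ / cfun (2 - lam)) * (1 + 1 / δ), T, by positivity, hT0, fun t ht => ?_⟩
  have ht1 : 1 ≤ t := le_trans (le_trans (le_max_right T₃ 1) (le_max_right _ _)) ht
  have ht0 : 0 < t := lt_of_lt_of_le one_pos ht1
  have htT₁ : T₁ ≤ t := le_trans (le_trans (le_max_left _ _) (le_max_left _ _)) ht
  have htT₂ : T₂ ≤ t := le_trans (le_trans (le_max_right _ _) (le_max_left _ _)) ht
  have htT₃ : T₃ ≤ t := le_trans (le_trans (le_max_left _ _) (le_max_right _ _)) ht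
  rw [greenSolI'_eq hlam ht0]
  have hφ : 0 < sph lam (hyp t) := sph_hyp_pos lam t
  have hs : 0 < Real.sinh (2 * t) := sinh_two_mul_pos ht0
  have h1 : |deriv (fun t => sph lam (hyp t)) t / sph lam (hyp t)| ≤ Cφ * (1 + t) := by
    rw [abs_div, abs_of_pos hφ, div_le_iff₀ hφ]
    exact hCφ t ht0.le
  have hsinh : Real.exp (2 * t) / 4 ≤ Real.sinh (2 * t) := exp_div_four_le_sinh (by linarith)
  have hφl : cfun (2 - lam) / 2 * Real.exp ((lam - 2) * t) ≤ sph lam (hyp t) := hT₃ t htT₃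
  have hprod : cfun (2 - lam) / 8 * Real.exp (lam * t) ≤ Real.sinh (2 * t) * sph lam (hyp t) := by
    calc cfun (2 - lam) / 8 * Real.exp (lam * t)
        = Real.exp (2 * t) / 4 * (cfun (2 - lam) / 2 * Real.exp ((lam - 2) * t)) := by
          rw [show Real.exp (lam * t) = Real.exp (2 * t) * Real.exp ((lam - 2) * t) by
            rw [← Real.exp_add]; congr 1; ring]
          ring
      _ ≤ Real.sinh (2 * t) * sph lam (hyp t) := mul_le_mul hsinh hφl (by positivity) hs.le
  have hB := hKT₂ t htT₂
  have h2' : |greenBI (fun t => sph lam (hyp t)) g t / (Real.sinh (2 * t) * sph lam (hyp t))|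
      ≤ 8 * K₂ / cfun (2 - lam) * (1 + t) * Real.exp (-(min ε lam) * t) := by
    rw [abs_div, abs_of_pos (mul_pos hs hφ), div_le_iff₀ (mul_pos hs hφ)]
    calc |greenBI (fun t => sph lam (hyp t)) g t| ≤ K₂ * (1 + t) * Real.exp (max (lam - ε) 0 * t) := hB
      _ = 8 * K₂ / cfun (2 - lam) * (1 + t) * Real.exp (-(min ε lam) * t)
          * (cfun (2 - lam) / 8 * Real.exp (lam * t)) := by
          have e : Real.exp (max (lam - ε) 0 * t) = Real.exp (-(min ε lam) * t) * Real.exp (lam * t) := by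
            rw [← Real.exp_add]; congr 1
            have : max (lam - ε) 0 = lam - min ε lam := by
              rcases le_total ε lam with h | h
              · rw [min_eq_left h, max_eq_left (by linarith)]
              · rw [min_eq_right h, max_eq_right (by linarith)]; ring
            rw [this]; ring
          rw [e]; field_simp
      _ ≤ 8 * K₂ / cfun (2 - lam) * (1 + t) * Real.exp (-(min ε lam) * t) * (Real.sinh (2 * t) * sph lam (hyp t)) :=
          mul_le_mul_of_nonneg_left hprod (by positivity)
  have h1t : 1 + t ≤ (1 + 1 / δ) * Real.exp (δ * t) := by
    have ha : (1 : ℝ) ≤ Real.exp (δ * t) := Real.one_le_exp (by positivity)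
    have hb : t ≤ Real.exp (δ * t) / δ := le_exp_div hδ0
    calc 1 + t ≤ Real.exp (δ * t) + Real.exp (δ * t) / δ := add_le_add ha hb
      _ = (1 + 1 / δ) * Real.exp (δ * t) := by ring
  have hmin : Real.exp (-(min ε lam) * t) ≤ Real.exp (-ε'' * t) := by
    apply Real.exp_le_exp.mpr; nlinarith [hε''2]
  have hδe : Real.exp (δ * t) * Real.exp (-ε'' * t) = Real.exp (-ε' * t) := by
    rw [← Real.exp_add]; congr 1; rw [hδ]; ring
  have hu := hKT₁ t htT₁
  have hsum : |deriv (fun t => sph lam (hyp t)) t / sph lam (hyp t)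
        * greenSolI (fun t => sph lam (hyp t)) (sphDecay lam) g t
        + greenBI (fun t => sph lam (hyp t)) g t / (Real.sinh (2 * t) * sph lam (hyp t))|
      ≤ Cφ * (1 + t) * (K₁ * Real.exp (-ε'' * t))
        + 8 * K₂ / cfun (2 - lam) * (1 + t) * Real.exp (-(min ε lam) * t) := by
    calc |deriv (fun t => sph lam (hyp t)) t / sph lam (hyp t) * greenSolI (fun t => sph lam (hyp t)) (sphDecay lam) g t
          + greenBI (fun t => sph lam (hyp t)) g t / (Real.sinh (2 * t) * sph lam (hyp t))|
        ≤ |deriv (fun t => sph lam (hyp t)) t / sph lam (hyp t)|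
            * |greenSolI (fun t => sph lam (hyp t)) (sphDecay lam) g t|
          + |greenBI (fun t => sph lam (hyp t)) g t / (Real.sinh (2 * t) * sph lam (hyp t))| := by
          rw [← abs_mul]; exact abs_add_le _ _
      _ ≤ Cφ * (1 + t) * (K₁ * Real.exp (-ε'' * t))
          + 8 * K₂ / cfun (2 - lam) * (1 + t) * Real.exp (-(min ε lam) * t) :=
          add_le_add (mul_le_mul h1 hu (abs_nonneg _) (by positivity)) h2'
  have hA : Cφ * (1 + t) * (K₁ * Real.exp (-ε'' * t))
      ≤ Cφ * K₁ * ((1 + 1 / δ) * Real.exp (δ * t)) * Real.exp (-ε'' * t) := by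
    calc Cφ * (1 + t) * (K₁ * Real.exp (-ε'' * t)) = Cφ * K₁ * (1 + t) * Real.exp (-ε'' * t) := by ring
      _ ≤ Cφ * K₁ * ((1 + 1 / δ) * Real.exp (δ * t)) * Real.exp (-ε'' * t) :=
          mul_le_mul_of_nonneg_right (mul_le_mul_of_nonneg_left h1t (by positivity)) (Real.exp_pos _).le
  have hB' : 8 * K₂ / cfun (2 - lam) * (1 + t) * Real.exp (-(min ε lam) * t)
      ≤ 8 * K₂ / cfun (2 - lam) * ((1 + 1 / δ) * Real.exp (δ * t)) * Real.exp (-ε'' * t) :=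
    mul_le_mul (mul_le_mul_of_nonneg_left h1t (by positivity)) hmin (Real.exp_pos _).le (by positivity)
  have hfin : ∀ a : ℝ, a * ((1 + 1 / δ) * Real.exp (δ * t)) * Real.exp (-ε'' * t) = a * (1 + 1 / δ) * Real.exp (-ε' * t) := by
    intro a
    rw [mul_assoc a, mul_assoc (1 + 1 / δ), hδe]
    ring
  calc _ ≤ _ := hsum
    _ ≤ Cφ * K₁ * ((1 + 1 / δ) * Real.exp (δ * t)) * Real.exp (-ε'' * t)
        + 8 * K₂ / cfun (2 - lam) * ((1 + 1 / δ) * Real.exp (δ * t)) * Real.exp (-ε'' * t) := add_le_add hA hB'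
    _ = (Cφ * K₁ + 8 * K₂ / cfun (2 - lam)) * (1 + 1 / δ) * Real.exp (-ε' * t) := by
        rw [hfin, hfin]; ring

end measure

end Summit.Ventures.HodgeRepro2.T5SU11ImproperDerivativeBoundsAll
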